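import Summits.Ventures.LatticeQCDFlow.Scoring.U1TorusSectorIntegrand
import Mathlib.Analysis.Convolution
import Mathlib.MeasureTheory.Function.ContinuousMapDense
import HarnessLib

/-!
# The sector weights of 2-d `U(1)` as Bochner convolution powers: integrability and continuity

HONEST FRAMING: exact (Metropolis-corrected) sampling algorithms for lattice gauge theory;
figures of merit are autocorrelation/cost numbers at stated couplings and volumes; no
continuum-physics claim.

Venture `LatticeQCDFlow` (cell pub-lqcd), sub-topic `Scoring`; FANOUT row 5 (`s0-sun-a`), GEN-8.
NEW WORK of the cell (placement rule).  `Scoring/U1TorusTopologicalChargeLaw.lean` proves the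
topological-charge law `P(Q = k) = g_V(2πk)/Σ_j g_V(2πj)` with `g_V = p_β^{*V}` the `[0,∞]`-valued
convolution power of `Scoring/RealConvolutionPowers.lean`.  The cell's oracle EVALUATES `g_V` by
Fourier inversion (`u1_torus_oracle.py`: `g_V(x) = (1/2π) ∫ e^{−iλx} f(λ)^V dλ`).  Towards typing
that step this file moves the convolution powers into Mathlib's Bochner `convolution` over `ℂ`:

* §1 `u1PlaqDensity β φ = e^{−β(1−cos φ)}`, the real weight `u1AngleWeightReal = 1_{[−π,π]}·q_β`, its
  complex version `u1AngleWeightC`; `u1AngleWeight = ENNReal.ofReal ∘ u1AngleWeightReal`;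
* §2 `cconvPow β n = p ⋆ (p ⋆ ⋯ ⋆ p)` (`n + 1` factors; `MeasureTheory.convolution` with
  `ContinuousLinearMap.mul ℂ ℂ` and Lebesgue measure) and the BRIDGE **`cconvPow_eq_convPow`**
  `cconvPow β n x = ((convPow (u1AngleWeight β) n x).toReal : ℂ)`; hence
  **`u1SectorWeight_toReal`** `(g_V(2πk) : ℂ) = cconvPow β (V−1) (2πk)`;
* §3 integrability of every power (`integrable_cconvPow`), the sup bound `norm_cconvPow_le`, and
  §4 CONTINUITY: `continuous_convolution_of_bdd` — `f ⋆ g` is continuous for `f` integrable and `g`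
  integrable and bounded (by `L¹`-approximation of `f` by continuous compactly supported functions,
  `Integrable.exists_hasCompactSupport_integral_sub_le`) — whence `continuous_cconvPow` for every
  power with `n ≥ 1` (the weight `p_β` itself jumps at `±π`).

Elementary real analysis on top of Mathlib; nothing is cited.  The Fourier representation is the
companion file `Scoring/U1SectorWeightFourier.lean`.
-/

noncomputable section

open MeasureTheory Set Real Filter Topology
open scoped ENNReal Convolution

namespace Summit.Ventures.LatticeQCDFlow.Scoring

/-! ### 1. The real and complex one-plaquette weights -/

/-- The smooth one-plaquette density `q_β(φ) = e^{−β(1 − cos φ)}`. -/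
def u1PlaqDensity (β : ℝ) (φ : ℝ) : ℝ := Real.exp (-(β * (1 - Real.cos φ)))

/-- The real one-plaquette weight on one period: `p_β = 1_{[−π,π]} · q_β`. -/
def u1AngleWeightReal (β : ℝ) : ℝ → ℝ := (Icc (-π) π).indicator (u1PlaqDensity β)

/-- The complex-valued one-plaquette weight `φ ↦ (p_β(φ) : ℂ)`. -/
def u1AngleWeightC (β : ℝ) (φ : ℝ) : ℂ := (u1AngleWeightReal β φ : ℂ)

variable (β : ℝ)

/-- `q_β` is continuous. -/
theorem continuous_u1PlaqDensity : Continuous (u1PlaqDensity β) := by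
  unfold u1PlaqDensity; fun_prop

/-- `0 < q_β`. -/
theorem u1PlaqDensity_pos (φ : ℝ) : 0 < u1PlaqDensity β φ := Real.exp_pos _

/-- `q_β ≤ e^{2|β|}`. -/
theorem u1PlaqDensity_le (φ : ℝ) : u1PlaqDensity β φ ≤ Real.exp (|β| * 2) := by
  unfold u1PlaqDensity
  refine Real.exp_le_exp.2 ?_
  have h1 : 0 ≤ 1 - Real.cos φ := by linarith [Real.cos_le_one φ]
  have h2 : 1 - Real.cos φ ≤ 2 := by linarith [Real.neg_one_le_cos φ]
  calc -(β * (1 - Real.cos φ)) ≤ |β * (1 - Real.cos φ)| := neg_le_abs _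
    _ = |β| * (1 - Real.cos φ) := by rw [abs_mul, abs_of_nonneg h1]
    _ ≤ |β| * 2 := mul_le_mul_of_nonneg_left h2 (abs_nonneg _)

/-- `0 ≤ p_β`. -/
theorem u1AngleWeightReal_nonneg (φ : ℝ) : 0 ≤ u1AngleWeightReal β φ := by
  unfold u1AngleWeightReal
  exact Set.indicator_nonneg (fun _ _ => (u1PlaqDensity_pos β _).le) _

/-- `p_β ≤ e^{2|β|}`. -/
theorem u1AngleWeightReal_le (φ : ℝ) : u1AngleWeightReal β φ ≤ Real.exp (|β| * 2) :=
  (Set.indicator_le_self' (fun _ _ => (Real.exp_pos _).le) φ).trans (u1PlaqDensity_le β φ)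

/-- `p_β` vanishes off `[−π, π]`. -/
theorem u1AngleWeightReal_eq_zero {φ : ℝ} (h : φ ∉ Icc (-π) π) : u1AngleWeightReal β φ = 0 := by
  unfold u1AngleWeightReal; rw [indicator_of_notMem h]

/-- `p_β` is measurable. -/
theorem measurable_u1AngleWeightReal : Measurable (u1AngleWeightReal β) :=
  (continuous_u1PlaqDensity β).measurable.indicator measurableSet_Icc

/-- The complex weight is the indicator of `(q_β : ℂ)` on `[−π, π]`. -/
theorem u1AngleWeightC_eq_indicator :
    u1AngleWeightC β = (Icc (-π) π).indicator fun φ => (u1PlaqDensity β φ : ℂ) := by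
  funext φ
  unfold u1AngleWeightC u1AngleWeightReal
  by_cases h : φ ∈ Icc (-π) π
  · rw [indicator_of_mem h, indicator_of_mem h]
  · rw [indicator_of_notMem h, indicator_of_notMem h, Complex.ofReal_zero]

/-- The complex weight is measurable. -/
theorem measurable_u1AngleWeightC : Measurable (u1AngleWeightC β) :=
  Complex.measurable_ofReal.comp (measurable_u1AngleWeightReal β)

/-- `‖(p_β φ : ℂ)‖ ≤ e^{2|β|}`. -/
theorem norm_u1AngleWeightC_le (φ : ℝ) : ‖u1AngleWeightC β φ‖ ≤ Real.exp (|β| * 2) := by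
  rw [u1AngleWeightC, Complex.norm_real, Real.norm_eq_abs,
    abs_of_nonneg (u1AngleWeightReal_nonneg β φ)]
  exact u1AngleWeightReal_le β φ

/-- The `[0,∞]`-valued weight of part 1 is `ENNReal.ofReal` of the real weight. -/
theorem u1AngleWeight_eq_ofReal (φ : ℝ) :
    u1AngleWeight β φ = ENNReal.ofReal (u1AngleWeightReal β φ) := by
  unfold u1AngleWeight u1AngleWeightReal u1PlaqDensity
  by_cases h : φ ∈ Icc (-π) π
  · rw [indicator_of_mem h, indicator_of_mem h]
  · rw [indicator_of_notMem h, indicator_of_notMem h, ENNReal.ofReal_zero]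

/-- The complex weight has compact support (in `[−π, π]`). -/
theorem hasCompactSupport_u1AngleWeightC : HasCompactSupport (u1AngleWeightC β) := by
  refine HasCompactSupport.intro (K := Icc (-π) π) isCompact_Icc fun φ hφ => ?_
  rw [u1AngleWeightC, u1AngleWeightReal_eq_zero β hφ, Complex.ofReal_zero]

/-- The complex weight is integrable. -/
theorem integrable_u1AngleWeightC : Integrable (u1AngleWeightC β) := by
  rw [u1AngleWeightC_eq_indicator]
  refine IntegrableOn.integrable_indicator ?_ measurableSet_Icc
  exact (Complex.continuous_ofReal.comp (continuous_u1PlaqDensity β)).continuousOn.integrableOn_compact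
    isCompact_Icc

/-! ### 2. Bochner convolution powers and the bridge to `convPow` -/

/-- The Bochner convolution powers of the complex weight: `cconvPow β 0 = p_β`,
`cconvPow β (n+1) = p_β ⋆ cconvPow β n` (`(f ⋆ g)(x) = ∫ f(t) g(x − t) dt`), i.e.
`cconvPow β n = p_β^{*(n+1)}`. -/
def cconvPow (β : ℝ) : ℕ → ℝ → ℂ
  | 0 => u1AngleWeightC β
  | n + 1 => u1AngleWeightC β ⋆[ContinuousLinearMap.mul ℂ ℂ] cconvPow β n

/-- `cconvPow β 0 = p_β`. -/
@[simp] theorem cconvPow_zero : cconvPow β 0 = u1AngleWeightC β := rfl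

/-- `cconvPow β (n+1) = p_β ⋆ cconvPow β n`. -/
theorem cconvPow_succ (n : ℕ) :
    cconvPow β (n + 1) = u1AngleWeightC β ⋆[ContinuousLinearMap.mul ℂ ℂ] cconvPow β n := rfl

/-- The recursion pointwise: `cconvPow β (n+1) x = ∫ t, p_β(t) · cconvPow β n (x − t) dt`. -/
theorem cconvPow_succ_apply (n : ℕ) (x : ℝ) :
    cconvPow β (n + 1) x = ∫ t, u1AngleWeightC β t * cconvPow β n (x - t) := by
  rw [cconvPow_succ, convolution_def]
  rfl

/-- The `[0,∞]`-valued powers are finite. -/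
theorem convPow_u1AngleWeight_ne_top (n : ℕ) (x : ℝ) : convPow (u1AngleWeight β) n x ≠ ∞ := by
  refine (lt_of_le_of_lt (convPow_le (measurable_u1AngleWeight β) (u1AngleWeight_le β) n x) ?_).ne
  refine ENNReal.mul_lt_top ENNReal.ofReal_lt_top (ENNReal.pow_lt_top ?_)
  exact lt_of_le_of_lt (lintegral_u1AngleWeight_le β)
    (ENNReal.mul_lt_top ENNReal.ofReal_lt_top ENNReal.ofReal_lt_top)

/-- **THE BRIDGE**: the Bochner powers are the (real, finite) `[0,∞]`-valued powers of
`Scoring/RealConvolutionPowers.lean`: `cconvPow β n x = ((p_β^{*(n+1)})(x) : ℂ)`. -/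
theorem cconvPow_eq_convPow (n : ℕ) (x : ℝ) :
    cconvPow β n x = ((convPow (u1AngleWeight β) n x).toReal : ℂ) := by
  induction n generalizing x with
  | zero =>
    rw [cconvPow_zero, convPow_zero, u1AngleWeight_eq_ofReal,
      ENNReal.toReal_ofReal (u1AngleWeightReal_nonneg β x)]
    rfl
  | succ n ih =>
    rw [cconvPow_succ_apply, convPow_succ, lconv]
    simp_rw [ih]
    -- the real integrand
    set h : ℝ → ℝ := fun t => u1AngleWeightReal β t * (convPow (u1AngleWeight β) n (x - t)).toReal
      with hh
    have hmeas : Measurable h :=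
      (measurable_u1AngleWeightReal β).mul
        (((measurable_convPow (measurable_u1AngleWeight β) n).comp
          (measurable_const.sub measurable_id)).ennreal_toReal)
    have hnn : ∀ t, 0 ≤ h t := fun t =>
      mul_nonneg (u1AngleWeightReal_nonneg β t) ENNReal.toReal_nonneg
    have hC : (fun t => u1AngleWeightC β t * ((convPow (u1AngleWeight β) n (x - t)).toReal : ℂ)) =
        fun t => (h t : ℂ) := by
      funext t; simp only [hh, u1AngleWeightC, Complex.ofReal_mul]
    rw [hC, integral_complex_ofReal, integral_eq_lintegral_of_nonneg_ae (Eventually.of_forall hnn)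
      hmeas.aestronglyMeasurable]
    congr 2
    refine lintegral_congr fun t => ?_
    rw [hh]
    simp only
    rw [ENNReal.ofReal_mul (u1AngleWeightReal_nonneg β t), ← u1AngleWeight_eq_ofReal,
      ENNReal.ofReal_toReal (convPow_u1AngleWeight_ne_top β n _), mul_comm]

/-- The Bochner powers are real and non-negative. -/
theorem cconvPow_re_nonneg (n : ℕ) (x : ℝ) : 0 ≤ (cconvPow β n x).re ∧ (cconvPow β n x).im = 0 := by
  rw [cconvPow_eq_convPow]
  exact ⟨by simp, Complex.ofReal_im _⟩

/-- **The sector weight in Bochner form**: `(g_V(2πk) : ℂ) = cconvPow β (V − 1) (2πk)`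
(`u1SectorWeight β V k` is finite, `u1SectorWeight_lt_top`). -/
theorem u1SectorWeight_toReal (V : ℕ) (k : ℤ) :
    ((u1SectorWeight β V k).toReal : ℂ) = cconvPow β (V - 1) (2 * π * k) := by
  rw [cconvPow_eq_convPow]
  rfl

/-! ### 3. Integrability and the sup bound -/

/-- Every Bochner power is integrable. -/
theorem integrable_cconvPow (n : ℕ) : Integrable (cconvPow β n) := by
  induction n with
  | zero => exact integrable_u1AngleWeightC β
  | succ n ih =>
    rw [cconvPow_succ]
    exact (integrable_u1AngleWeightC β).integrable_convolution (ContinuousLinearMap.mul ℂ ℂ) ih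

/-- `∫ p_β ≤ 2π e^{2|β|}` (the `L¹` norm of the weight, real form). -/
theorem lintegral_u1AngleWeight_toReal_le :
    (∫⁻ t, u1AngleWeight β t).toReal ≤ Real.exp (|β| * 2) * (2 * π) := by
  have h := lintegral_u1AngleWeight_le β
  have hne : ENNReal.ofReal (Real.exp (|β| * 2)) * ENNReal.ofReal (2 * π) ≠ ∞ :=
    ENNReal.mul_ne_top ENNReal.ofReal_ne_top ENNReal.ofReal_ne_top
  calc (∫⁻ t, u1AngleWeight β t).toReal
      ≤ (ENNReal.ofReal (Real.exp (|β| * 2)) * ENNReal.ofReal (2 * π)).toReal :=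
        ENNReal.toReal_mono hne h
    _ = Real.exp (|β| * 2) * (2 * π) := by
        rw [ENNReal.toReal_mul, ENNReal.toReal_ofReal (Real.exp_pos _).le,
          ENNReal.toReal_ofReal (by positivity)]

/-- **Sup bound**: `‖cconvPow β n x‖ ≤ e^{2|β|} · (2π e^{2|β|})^n`. -/
theorem norm_cconvPow_le (n : ℕ) (x : ℝ) :
    ‖cconvPow β n x‖ ≤ Real.exp (|β| * 2) * (Real.exp (|β| * 2) * (2 * π)) ^ n := by
  rw [cconvPow_eq_convPow, Complex.norm_real, Real.norm_eq_abs, abs_of_nonneg ENNReal.toReal_nonneg]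
  have h := convPow_le (measurable_u1AngleWeight β) (u1AngleWeight_le β) n x
  have hne : ENNReal.ofReal (Real.exp (|β| * 2)) * (∫⁻ t, u1AngleWeight β t) ^ n ≠ ∞ := by
    refine ENNReal.mul_ne_top ENNReal.ofReal_ne_top (ENNReal.pow_ne_top ?_)
    exact (lt_of_le_of_lt (lintegral_u1AngleWeight_le β)
      (ENNReal.mul_lt_top ENNReal.ofReal_lt_top ENNReal.ofReal_lt_top)).ne
  calc (convPow (u1AngleWeight β) n x).toReal
      ≤ (ENNReal.ofReal (Real.exp (|β| * 2)) * (∫⁻ t, u1AngleWeight β t) ^ n).toReal :=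
        ENNReal.toReal_mono hne h
    _ = Real.exp (|β| * 2) * ((∫⁻ t, u1AngleWeight β t).toReal) ^ n := by
        rw [ENNReal.toReal_mul, ENNReal.toReal_ofReal (Real.exp_pos _).le, ENNReal.toReal_pow]
    _ ≤ Real.exp (|β| * 2) * (Real.exp (|β| * 2) * (2 * π)) ^ n := by
        gcongr
        exact lintegral_u1AngleWeight_toReal_le β

/-! ### 4. Continuity of the powers `n ≥ 1` -/

/-- **`f ⋆ g` is continuous for `f` integrable and `g` integrable and bounded** (real line,
Lebesgue measure, multiplication of complex values).  Proof: approximate `f` in `L¹` by a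
continuous compactly supported `f₀`; `f₀ ⋆ g` is continuous
(`BddAbove.continuous_convolution_left_of_integrable`) and `‖f ⋆ g − f₀ ⋆ g‖_∞ ≤ M ‖f − f₀‖₁`. -/
theorem continuous_convolution_of_bdd {f g : ℝ → ℂ} (hf : Integrable f) (hg : Integrable g)
    {M : ℝ} (hM : ∀ x, ‖g x‖ ≤ M) :
    Continuous (f ⋆[ContinuousLinearMap.mul ℂ ℂ] g) := by
  have hM0 : 0 ≤ M := (norm_nonneg _).trans (hM 0)
  refine continuous_of_uniform_approx_of_continuous fun u hu => ?_
  obtain ⟨ε, hε, hεu⟩ := Metric.mem_uniformity_dist.1 hu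
  obtain ⟨f₀, hf₀c, hf₀ε, hf₀cont, hf₀int⟩ :=
    hf.exists_hasCompactSupport_integral_sub_le (ε := ε / (2 * (M + 1))) (by positivity)
  refine ⟨f₀ ⋆[ContinuousLinearMap.mul ℂ ℂ] g, ?_, fun y => hεu ?_⟩
  · -- `f₀` is continuous with compact support, hence bounded; `g` is integrable
    exact (hf₀cont.norm.bddAbove_range_of_hasCompactSupport hf₀c.norm).continuous_convolution_left_of_integrable
      (ContinuousLinearMap.mul ℂ ℂ) hf₀cont hg
  · -- uniform closeness
    have hgy : AEStronglyMeasurable (fun t => g (y - t)) volume :=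
      hg.aestronglyMeasurable.comp_quasiMeasurePreserving
        (Measure.measurePreserving_sub_left volume y).quasiMeasurePreserving
    have h1 : Integrable (fun t => f t * g (y - t)) :=
      hf.mul_bdd hgy (Eventually.of_forall fun t => hM _)
    have h2 : Integrable (fun t => f₀ t * g (y - t)) :=
      hf₀int.mul_bdd hgy (Eventually.of_forall fun t => hM _)
    rw [dist_eq_norm, convolution_def, convolution_def]
    simp only [ContinuousLinearMap.mul_apply']
    rw [← integral_sub h1 h2]
    calc ‖∫ t, (f t * g (y - t) - f₀ t * g (y - t))‖
        ≤ ∫ t, ‖f t * g (y - t) - f₀ t * g (y - t)‖ := norm_integral_le_integral_norm _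
      _ ≤ ∫ t, ‖f t - f₀ t‖ * M := by
          refine integral_mono_of_nonneg (Eventually.of_forall fun t => norm_nonneg _)
            ((hf.sub hf₀int).norm.mul_const M) (Eventually.of_forall fun t => ?_)
          show ‖f t * g (y - t) - f₀ t * g (y - t)‖ ≤ ‖f t - f₀ t‖ * M
          rw [← sub_mul, norm_mul]
          exact mul_le_mul_of_nonneg_left (hM _) (norm_nonneg _)
      _ = (∫ t, ‖f t - f₀ t‖) * M := integral_mul_const _ _
      _ ≤ ε / (2 * (M + 1)) * M := mul_le_mul_of_nonneg_right hf₀ε hM0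
      _ < ε := by
          have : ε / (2 * (M + 1)) * M < ε / (2 * (M + 1)) * (2 * (M + 1)) :=
            mul_lt_mul_of_pos_left (by linarith) (by positivity)
          rwa [div_mul_cancel₀ _ (by positivity)] at this

/-- **The convolution powers `p_β^{*(n+1)}`, `n ≥ 1`, are continuous** (although `p_β` is not). -/
theorem continuous_cconvPow {n : ℕ} (hn : 1 ≤ n) : Continuous (cconvPow β n) := by
  obtain ⟨m, rfl⟩ := Nat.exists_eq_add_of_le' hn
  rw [cconvPow_succ]
  exact continuous_convolution_of_bdd (integrable_u1AngleWeightC β) (integrable_cconvPow β m)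
    (norm_cconvPow_le β m)

end Summit.Ventures.LatticeQCDFlow.Scoring
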